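import Summits.ResolutionOfSingularities.ResolutionOfSingularities.Theorems.PurelyInseparableDim4AtlasNodes
import Summits.ResolutionOfSingularities.ResolutionOfSingularities.Theorems.PurelyInseparableDim4AtlasShearReading
import HarnessLib

/-!
# Purely inseparable four-folds: the ROOT of the atlas forest AFTER A LINEAR RE-COORDINATISATION — a marked resolution of `z^p + F`
# from a tranche-1 plan at the SHEARED root host (brick S3 (c) v4, tranche 1½; cell `res-dim4-pi`)

[OURS · counted 0] (D-0157 DOOR 2; host item stmt-ResolutionOfSingularities-16155, helper). Nothing here proves resolution of
singularities in dimension ≥ 4 / characteristic `p`. Finding E-V4-4 (`res-dim4-typ-3/S3c-V4-ATLAS-MEMBERS-DESIGN.md` §16): escaping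
children whose fibre directions are not coordinate become tranche-1 LINEAR children after a linear change of the centre variables. At the
ROOT the boundary is empty, so ANY `K`-automorphism `τ` of `K[x₁..x₄]` mapping `(x_S)` into itself (both directions) is admissible: the
root host `c₀` of `z^p + F` (tranche 1's `root_member_package`, `root_memberDataAT` p720537) read through the sheared zigzag of G1
(`zigzag_shear_reading`, p725696) carries `MemberDataAT` with the single reading `(s̃, S, ∅, ∅)`,
`s̃ = ⟨clean(τ(clean(F(x + b)))), 0, ∅⟩`, as soon as tranche 1's `BlockA` holds along `AEdge` from it and it is `AEdge`-accessible; the node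
theorem A5 (`exists_isMarkedResolution_of_atlas_node`) then yields a marked order-`p` reduction of `z^p + F`. So every `F` whose v4 plan is
tranche-1-linear AFTER ONE LINEAR RE-COORDINATISATION OF THE ROOT is certified — e.g. the children at `ξ₁ = c·ξ₀` of §14 (b).

* `deletePthPowers_map_ne_zero_of_isClean`, `le_ordAlong_map_of_forall_mem_span` (any `(x_T)`-preserving algebra map keeps
  `T`-permissibility; typ-2 g8's `le_ordAlong_shear` is the one-pivot case), **`root_memberDataAT_shear`**,
  **`exists_isMarkedResolution_atlas_root_shear`**.

AI-produced formalisation, weaker than expert review. bears_on: LADDER-RESOLUTION:D157-DOOR2 (res-dim4-pi · S3 (c) v4 sheared root).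
-/

set_option linter.dupNamespace false -- D-0017: single-problem summit path `Summit.<S>.<S>.…` by design

noncomputable section

open MvPolynomial Finset CategoryTheory AlgebraicGeometry Opposite TopologicalSpace
open AlgebraicGeometry.Scheme.IdealSheafData (ofIdealTop vanishingIdeal)

namespace Summit.ResolutionOfSingularities.ResolutionOfSingularities.Theorems.PIDim4

open Literature.AlgebraicGeometry.Resolution
open Literature.AlgebraicGeometry.Resolution.Hauser2010
open Literature.AlgebraicGeometry.Resolution.AffinePointBlowup (P A γ coord Wtop ξ)
open Literature.AlgebraicGeometry.Hironaka2017.CoordArrangement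

namespace Equimultiple

section RootShear

variable {K : Type} [Field K] {p : ℕ} [hp : Fact p.Prime] [CharP K p] [DecidableEq K]

omit [DecidableEq K] in
/-- A `K`-algebra automorphism cannot turn a non-zero CLEAN polynomial into a sum of `p`-th powers: `clean(τ F) ≠ 0`.
[cite: HauserPerlega2019PRIMS, §2 (cleaning)] -/
theorem deletePthPowers_map_ne_zero_of_isClean [PerfectRing K p] (τ : MvPolynomial (Fin 4) K ≃ₐ[K] MvPolynomial (Fin 4) K)
    {F : MvPolynomial (Fin 4) K} (hF : F ≠ 0) (hclean : Literature.Barriers.ResolutionOfSingularities.HauserPerlega.IsClean p F) :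
    deletePthPowers p (τ F) ≠ 0 := by
  intro h0
  have h1 := ChartDictionary.deletePthPowers_map_eq_zero (p := p) (τ.symm : MvPolynomial (Fin 4) K →ₐ[K] MvPolynomial (Fin 4) K) h0
  rw [AlgEquiv.coe_toAlgHom, AlgEquiv.symm_apply_apply,
    Literature.Barriers.ResolutionOfSingularities.HauserPerlega.deletePthPowers_eq_self hclean] at h1
  exact hF h1

omit hp [CharP K p] [DecidableEq K] in
/-- **An `(x_T)`-preserving algebra map keeps `T`-permissibility**: `q ≤ ord_{(x_T)} F ⇒ q ≤ ord_{(x_T)} (τ F)`.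
[cite: HauserPerlega2019PRIMS, §2 (ord_P)] -/
theorem le_ordAlong_map_of_forall_mem_span {T : Finset (Fin 4)} (τ : MvPolynomial (Fin 4) K →ₐ[K] MvPolynomial (Fin 4) K)
    (hτ : ∀ i ∈ T, τ (X i) ∈ Ideal.span (X '' (T : Set (Fin 4)) : Set (MvPolynomial (Fin 4) K)))
    {q : ℕ} {F : MvPolynomial (Fin 4) K} (hperm : (q : ℕ∞) ≤ CentreBlowup.ordAlong T F) :
    (q : ℕ∞) ≤ CentreBlowup.ordAlong T (τ F) := by
  classical
  have hI : (Ideal.span (X '' (T : Set (Fin 4)) : Set (MvPolynomial (Fin 4) K))).map τ ≤ Ideal.span (X '' (T : Set (Fin 4))) := by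
    rw [Ideal.map_span]
    refine Ideal.span_le.mpr ?_
    rintro _ ⟨_, ⟨i, hi, rfl⟩, rfl⟩
    exact hτ i hi
  have hmem : τ F ∈ Ideal.span (X '' (T : Set (Fin 4)) : Set (MvPolynomial (Fin 4) K)) ^ q := by
    have h1 : τ F ∈ (Ideal.span (X '' (T : Set (Fin 4)) : Set (MvPolynomial (Fin 4) K)) ^ q).map τ :=
      Ideal.mem_map_of_mem _ (ChartDictionary.mem_pow_span_X_of_le_ordAlong q T F hperm)
    rw [Ideal.map_pow] at h1
    exact Ideal.pow_right_mono hI q h1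
  rw [CentreBlowup.le_ordAlong_iff]
  intro d hd
  have h := (mem_pow_span_X_iff.mp hmem) d hd
  rw [ChartDictionary.sdeg_coe_eq_degIn] at h
  exact_mod_cast h

/-- **The SHEARED root host as an atlas member with one reading.** [cite: BierstoneGrigorievMilmanWlodarczyk2011, Def. 3.1.3]
[cite: Hauser2010, §G (coordinate changes and cleaning)] -/
theorem root_memberDataAT_shear [IsAlgClosed K] [DecidableEq (AReading K)] (F : MvPolynomial (Fin 4) K) (hF : F ≠ 0)
    (hclean : Literature.Barriers.ResolutionOfSingularities.HauserPerlega.IsClean p F)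
    (plan : AReading K → Finset (Fin 4 × (Fin 4 → K) × Finset (Fin 4)))
    (leaves : AReading K → Finset (Fin 4 × (Fin 4 → K))) (b : Fin 4 → K) (S : Finset (Fin 4))
    (hS : IsPermissibleCentre p S (deletePthPowers p (PointBlowup.translate b F)))
    (τ : MvPolynomial (Fin 4) K ≃ₐ[K] MvPolynomial (Fin 4) K)
    (hτ : ∀ i ∈ S, τ (X i) ∈ Ideal.span (X '' (S : Set (Fin 4)) : Set (MvPolynomial (Fin 4) K)))
    (hτ' : ∀ i ∈ S, τ.symm (X i) ∈ Ideal.span (X '' (S : Set (Fin 4)) : Set (MvPolynomial (Fin 4) K)))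
    (s : State K) (hs : s = ⟨deletePthPowers p (τ (deletePthPowers p (PointBlowup.translate b F))), 0, ∅⟩)
    (hblocks : ∀ q : AReading K, Relation.ReflTransGen (fun a e : AReading K => AEdge p plan e a)
      (s, S, (∅ : Finset (Fin 4 × K)), (∅ : Finset (Fin 4))) q → BlockA p plan leaves q)
    (hacc : Acc (fun q' q : AReading K => AEdge p plan q' q) (s, S, (∅ : Finset (Fin 4 × K)), (∅ : Finset (Fin 4)))) :
    ∃ c₀ : Closeds (P 4 K),
      MemberDataAT p plan leaves (⟨hypSheaf p F, [], p⟩ : MarkedIdeal (P 4 K)) c₀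
        ({(s, S, (∅ : Finset (Fin 4 × K)), (∅ : Finset (Fin 4)))} : Finset (AReading K)) ∧
      (∀ z : P 4 K, z ∈ (c₀ : Set (P 4 K)) → ∀ i ∈ S, (X i.succ - C (b i) : A 4 K) ∈ z.asIdeal) ∧
      (∀ z : P 4 K, IsClosed ({z} : Set (P 4 K)) → (1 : ℕ∞) ≤ idealOrder (hypSheaf p F) z →
        (∀ i ∈ S, (X i.succ - C (b i) : A 4 K) ∈ z.asIdeal) → z ∈ (c₀ : Set (P 4 K))) := by
  classical
  haveI : PerfectRing K p := PerfectRing.ofSurjective K p fun x => IsAlgClosed.exists_pow_nat_eq x hp.out.pos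
  set G : MvPolynomial (Fin 4) K := deletePthPowers p (PointBlowup.translate b F) with hG
  obtain ⟨c₀, hreg, hsnc, ⟨Y, φ, ψ, hφ, hψ, hM, hZ, hcφ, hsee⟩, hin, hall⟩ := root_member_package (p := p) F b hS
  -- the unsheared root state
  have hG₀ : G ≠ 0 := deletePthPowers_translate_ne_zero hF hclean b
  have hcleanG : Literature.Barriers.ResolutionOfSingularities.HauserPerlega.IsClean p G := isClean_deletePthPowers _
  have hM₀ : (⟨hypSheaf p F, [], p⟩ : MarkedIdeal (P 4 K)).ideal.comap φ = (hypSheaf p G).comap ψ := hM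
  -- G1: the sheared reading
  have hordG : (1 : ℕ∞) ≤ CentreBlowup.ordAlong S G :=
    le_trans (by exact_mod_cast hp.out.one_lt.le) hS.2
  obtain ⟨ψ', hψ', hM', hZ', hsee', -, hown'⟩ :=
    zigzag_shear_reading (p := p) φ ψ _ _ hM₀ hZ hsee hordG τ hτ hτ'
  -- the sheared root state
  have hF₀ : s.F ≠ 0 := by rw [hs]; exact deletePthPowers_map_ne_zero_of_isClean τ hG₀ hcleanG
  have hclean₀ : Literature.Barriers.ResolutionOfSingularities.HauserPerlega.IsClean p s.F := by
    rw [hs]; exact isClean_deletePthPowers _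
  have hS₀ : IsPermissibleCentre p S s.F := by
    rw [hs]
    refine ⟨hS.1, le_trans ?_ (ChartDictionary.ordAlong_le_ordAlong_deletePthPowers p S _)⟩
    exact le_ordAlong_map_of_forall_mem_span (τ : MvPolynomial (Fin 4) K →ₐ[K] MvPolynomial (Fin 4) K) hτ hS.2
  have hMs : (⟨hypSheaf p F, [], p⟩ : MarkedIdeal (P 4 K)).ideal.comap φ = (hypSheaf p s.F).comap ψ' := by rw [hs]; exact hM'
  have himg : φ '' (ψ ⁻¹' (AffineCoordBlowup.CΛ 4 K (insert 0 (Fin.succ '' (S : Set (Fin 4)))) : Set (P 4 K))) = (c₀ : Set (P 4 K)) :=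
    coe_member_eq_image φ ψ c₀ hZ hcφ
  have hpre' : ψ' ⁻¹' (AffineCoordBlowup.CΛ 4 K (insert 0 (Fin.succ '' (S : Set (Fin 4)))) : Set (P 4 K)) =
      ψ ⁻¹' (AffineCoordBlowup.CΛ 4 K (insert 0 (Fin.succ '' (S : Set (Fin 4)))) : Set (P 4 K)) := by
    have h := hown' ∅ (fun iv hiv => absurd hiv (Finset.notMem_empty iv))
    rw [ownedSetZ_empty] at h
    exact h
  have himg' : φ '' (ψ' ⁻¹' (AffineCoordBlowup.CΛ 4 K (insert 0 (Fin.succ '' (S : Set (Fin 4)))) : Set (P 4 K))) = (c₀ : Set (P 4 K)) := by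
    rw [hpre', himg]
  have hr : ∀ r : ↥({(s, S, (∅ : Finset (Fin 4 × K)), (∅ : Finset (Fin 4)))} : Finset (AReading K)),
      (r : AReading K) = (s, S, (∅ : Finset (Fin 4 × K)), (∅ : Finset (Fin 4))) := fun r => Finset.mem_singleton.mp r.2
  have hown : ∀ v : Fin 4 → K, ownedSetZ S ((∅ : Finset (Fin 4)).image fun m => (m, v m)) =
      (AffineCoordBlowup.CΛ 4 K (insert 0 (Fin.succ '' (S : Set (Fin 4)))) : Set (P 4 K)) := fun v => by
    rw [Finset.image_empty]; exact ownedSetZ_empty S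
  haveI := hψ'
  refine ⟨c₀, ⟨fun r hr' => ?_, fun r hr' => ?_, hreg, hsnc, ⟨fun _ => Y, fun _ => φ, fun _ => ψ', fun r => ?_, ?_, ?_⟩,
    fun r hr' q hq => ?_, fun r hr' => ?_⟩, hin, hall⟩
  · rw [Finset.mem_singleton.mp hr']; exact ⟨hF₀, hclean₀, hS₀⟩
  · rw [Finset.mem_singleton.mp hr']
    exact ⟨fun iv hiv => absurd hiv (Finset.notMem_empty iv), fun m hm => absurd hm (Finset.notMem_empty m)⟩
  · rw [hr r]
    refine ⟨hφ, hψ', hMs, hZ', hsee', fun v => ?_, fun _ => 0, fun _ => 0, fun D hD => absurd hD List.not_mem_nil,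
      fun D₁ hD₁ => absurd hD₁ List.not_mem_nil⟩
    change IsClosed (φ '' (ψ' ⁻¹' ownedSetZ S ((∅ : Finset (Fin 4)).image fun m => (m, v m))))
    rw [hown v, himg']
    exact c₀.isClosed
  · intro x hx
    refine Set.mem_iUnion.mpr ⟨⟨_, Finset.mem_singleton_self _⟩, ?_⟩
    change x ∈ φ '' (ψ' ⁻¹' ownedSetZ S (∅ : Finset (Fin 4 × K)))
    rw [ownedSetZ_empty, himg']
    exact hx
  · intro r r' hne
    exact absurd (Subtype.ext ((hr r).trans (hr r').symm)) hne
  · rw [Finset.mem_singleton.mp hr'] at hq; exact hblocks q hq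
  · rw [Finset.mem_singleton.mp hr']; exact hacc

/-- **A MARKED RESOLUTION OF `z^p + F` FROM A TRANCHE-1 PLAN AT THE SHEARED ROOT HOST.** `F ≠ 0` clean; root point `b`, centre `S`
permissible for `clean(F(x + b))`; ANY `K`-automorphism `τ` of `K[x]` with `τ(x_S), τ⁻¹(x_S) ⊆ (x_S)`; root reading
`(⟨clean(τ(clean(F(x + b)))), 0, ∅⟩, S, ∅, ∅)` with tranche 1's `BlockA` along `AEdge` from it and `AEdge`-accessible; every closed point of
order `≥ p` with `x_S = b_S` ⇒ a marked resolution of `(𝔸⁵, (z^p + F), ∅, p)`. [cite: BierstoneGrigorievMilmanWlodarczyk2011, Def. 3.1.3;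
Thm. 1.1 (char. 0 model)] [cite: Hauser2010, §§F–G] -/
theorem exists_isMarkedResolution_atlas_root_shear [IsAlgClosed K] [DecidableEq (AReading K)] (F : MvPolynomial (Fin 4) K)
    (hF : F ≠ 0) (hclean : Literature.Barriers.ResolutionOfSingularities.HauserPerlega.IsClean p F)
    (plan : AReading K → Finset (Fin 4 × (Fin 4 → K) × Finset (Fin 4)))
    (leaves : AReading K → Finset (Fin 4 × (Fin 4 → K))) (b : Fin 4 → K) (S : Finset (Fin 4))
    (hS : IsPermissibleCentre p S (deletePthPowers p (PointBlowup.translate b F)))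
    (τ : MvPolynomial (Fin 4) K ≃ₐ[K] MvPolynomial (Fin 4) K)
    (hτ : ∀ i ∈ S, τ (X i) ∈ Ideal.span (X '' (S : Set (Fin 4)) : Set (MvPolynomial (Fin 4) K)))
    (hτ' : ∀ i ∈ S, τ.symm (X i) ∈ Ideal.span (X '' (S : Set (Fin 4)) : Set (MvPolynomial (Fin 4) K)))
    (s : State K) (hs : s = ⟨deletePthPowers p (τ (deletePthPowers p (PointBlowup.translate b F))), 0, ∅⟩)
    (hblocks : ∀ q : AReading K, Relation.ReflTransGen (fun a e : AReading K => AEdge p plan e a)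
      (s, S, (∅ : Finset (Fin 4 × K)), (∅ : Finset (Fin 4))) q → BlockA p plan leaves q)
    (hacc : Acc (fun q' q : AReading K => AEdge p plan q' q) (s, S, (∅ : Finset (Fin 4 × K)), (∅ : Finset (Fin 4))))
    (hcover : ∀ z : P 4 K, IsClosed ({z} : Set (P 4 K)) → (p : ℕ∞) ≤ idealOrder (hypSheaf p F) z →
      ∀ i ∈ S, (X i.succ - C (b i) : A 4 K) ∈ z.asIdeal) :
    ∃ (X' : Scheme.{0}) (ρ : X' ⟶ P 4 K) (M' : MarkedIdeal X'),
      IsMarkedResolution (⟨hypSheaf p F, [], p⟩ : MarkedIdeal (P 4 K)) ρ M' := by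
  classical
  set M₀ : MarkedIdeal (P 4 K) := ⟨hypSheaf p F, [], p⟩ with hM₀
  have hE₀ : HasSNC M₀.boundary :=
    hasSNC_nil_of_isRegular (Literature.AlgebraicGeometry.Hironaka2017.Lib.AffinePointBlowupLSB.isRegular_Z 4 K)
  obtain ⟨c₀, hdata, -, hall⟩ := root_memberDataAT_shear (p := p) F hF hclean plan leaves b S hS τ hτ hτ' s hs hblocks hacc
  refine exists_isMarkedResolution_of_atlas_node M₀ hE₀ rfl plan leaves ∅ (fun _ => s) (fun x hx => absurd hx (Finset.notMem_empty x))
    (fun x hx => absurd hx (Finset.notMem_empty x)) {c₀} (fun _ => {(s, S, (∅ : Finset (Fin 4 × K)), (∅ : Finset (Fin 4)))})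
    (fun c hc => by rw [Finset.mem_singleton.mp hc]; exact hdata)
    (fun c hc c' hc' hcc => absurd ((Finset.mem_singleton.mp hc).trans (Finset.mem_singleton.mp hc').symm) hcc)
    (fun x hx => absurd hx (Finset.notMem_empty x)) fun z hz hzo => Or.inr ⟨c₀, Finset.mem_singleton_self _, ?_⟩
  exact hall z hz (le_trans (by exact_mod_cast hp.out.one_lt.le) hzo) (hcover z hz hzo)

end RootShear

end Equimultiple

end Summit.ResolutionOfSingularities.ResolutionOfSingularities.Theorems.PIDim4

end
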